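import Summits.CriticalPhenomena.CardyFormulaZ2.Theorems.CardyFlipRussoCoveringLegStubCoveringBridgeCoupling
import Summits.CriticalPhenomena.CardyFormulaZ2.Theorems.CardyFlipRussoCoveringLegStubCoveringBridgeSandwich
import Summits.CriticalPhenomena.CardyFormulaZ2.Theorems.CardyFlipRussoCoveringLegDefs
import HarnessLib

/-!
# `stub_coveringBridge` reduced to boundary insensitivity of crude bond crossings (line `five-arm-null`)

Helper file `--supports stmt-CriticalPhenomena-6435` (stub `stub_coveringBridge` =
`CardySectorGap.CoveringBridge`, stmt-CriticalPhenomena-7055: Cardy for the crude mixed crossing of `G_s` at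
`q = 0` implies Cardy for the crude bond-`ℤ²` event `embDomainCrossing squareLatticeEmbedding.z`).

What is landed exactly (this file and its imports): Kesten's covering coupling
`map coverMap (bondPercolation (zdGraph 2) half) = prodBernoulli (mixedParam 0)` (`cover_map_bondPercolation`)
and the event sandwich at every fixed mesh `δ > 0`,
`P^{bond}(small_δ) ≤ P_{1/2,0}(cross_δ) ≤ P^{bond}(big_δ)` and `P^{bond}(small_δ) ≤ P^{bond}(cross^{bond}_δ) ≤ P^{bond}(big_δ)`,
where `small_δ` is the crude bond crossing `embDomainCrossing` of the `δ`-ERODED window `{w | closedBall w δ ⊆ Ω}`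
(same arcs, same `2δ` slack) and `big_δ` the crude bond crossing `embDomainCrossing` of the `δ`-THICKENED data
`(thickening δ Ω; thickening δ (R.arc 0), thickening δ (R.arc 2))` at the same mesh.  Hence
(`coveringBridge_of_boundaryInsensitivity`) the stub follows from the one analytic statement NOT in the tree,

  `BoundaryInsensitivity`: `∀ R, P^{bond}(big_δ(R)) − P^{bond}(small_δ(R)) → 0` as `δ → 0⁺`,

i.e. crude crossing probabilities of critical bond-`ℤ²` are insensitive to a `δ`-thickening / `δ`-erosion of
the domain data (RSW control of open paths grazing `∂Ω`; Beffara 2008 §5.2 "Russo–Seymour–Welsh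
estimates are actually enough"; Grimmett–Manolescu 2014 §2.2; for general Jordan `∂Ω` a harmonic-measure /
three-arm estimate in the boundary collar).  The squeeze itself is two `Tendsto` lines.
-/

noncomputable section

namespace Summit.CriticalPhenomena.CardyFormulaZ2.Cruxes.CoveringLeg.FiveArmNull

open MeasureTheory Measure ProbabilityTheory unitInterval Filter Topology
open Literature.Probability.LatticeModels
open Literature.Probability.Percolation
open Literature.Probability.RandomPlanarGeometry
open Literature.Barriers.CriticalPhenomena (MixedSite mixedParam)

/-! ### The probability sandwich -/

/-- The Defs module's `zS` IS the covering-adapted embedding written out in the companion files (eta).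
[cite: Beffara2008Universal, §5.1] -/
theorem cover_zS_eq : zS = (Sum.elim (fun x : ℤ × ℤ => (((x.1 + x.2 : ℤ) : ℂ) + ((x.2 - x.1 + 1 : ℤ) : ℂ) * Complex.I) / (Real.sqrt 2 : ℂ)) (fun f : ℤ × ℤ => (((f.1 + f.2 + 1 : ℤ) : ℂ) + ((f.2 - f.1 + 1 : ℤ) : ℂ) * Complex.I) / (Real.sqrt 2 : ℂ)) : MixedSite → ℂ) :=
  rfl


/-- **Finite window in the line's vocabulary**: at mesh `δ ≠ 0` only finitely many vertices of `G_s` are drawn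
inside the (bounded) carrier of `R` by `zS` — the finite-support lemma used by the pivotal masses `massII`,
`massIII` of the line. [folklore] -/
theorem cover_window_finite_zS (R : ConformalRectangle) {δ : ℝ} (hδ : δ ≠ 0) :
    {y : MixedSite | (δ : ℂ) * zS y ∈ R.carrier}.Finite := by
  rw [cover_zS_eq]; exact cover_window_finite R.isBounded hδ

/-- **The crude crossing event `crossS R δ` of the line is measurable** (`δ ≠ 0`). [folklore] -/
theorem cover_measurableSet_crossS (R : ConformalRectangle) {δ : ℝ} (hδ : δ ≠ 0) :
    MeasurableSet (crossS R δ) := by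
  rw [crossS_eq, gsGraph_eq, cover_zS_eq]
  exact cover_measurableSet_siteCross R.isBounded hδ _ _

/-- **Lower half of the sandwich**: `P^{bond}_{1/2}(crude crossing of the δ-eroded window) ≤ P_{1/2,0}(crude
site crossing of Ω)` (direction B on the almost sure event `η ⊆ E(ℤ²)`, then the coupling; no
measurability needed on this side). [cite: Beffara2008Universal, §5.1] -/
theorem cover_prob_sandwich_lower (Ω A B : Set ℂ) {δ : ℝ} (hδ : 0 < δ) :
    (bondPercolation (zdGraph 2) half).real
        (embDomainCrossing squareLatticeEmbedding.z {w | Metric.closedBall w δ ⊆ Ω} δ A B) ≤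
      (prodBernoulli (mixedParam 0)).real (siteEmbDomainCrossing centredSquareGraph zS Ω δ A B) := by
  rw [cover_zS_eq]
  refine le_trans ?_ (cover_real_preimage_le _)
  have hae : ∀ᵐ η ∂ bondPercolation (zdGraph 2) half, η ⊆ (zdGraph 2).edgeSet := setBernoulli_ae_subset
  refine ENNReal.toReal_mono (measure_ne_top _ _) (measure_mono_ae ?_)
  filter_upwards [hae] with η hη hsmall
  exact cover_bondCross_subset_preimage Ω A B hδ hη hsmall

/-- **Upper half of the sandwich** (bounded `Ω`): `P_{1/2,0}(crude site crossing of (Ω; A, B)) ≤ P^{bond}_{1/2}(crude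
bond crossing of the δ-thickened data (Ω_δ; A_δ, B_δ))` (the coupling on the measurable site event, direction A,
and the slack transfer `cover_infDist_thickening_le`). [cite: Beffara2008Universal, §5.1] -/
theorem cover_prob_sandwich_upper {Ω : Set ℂ} (hΩ : Bornology.IsBounded Ω) (A B : Set ℂ) {δ : ℝ}
    (hδ : 0 < δ) :
    (prodBernoulli (mixedParam 0)).real (siteEmbDomainCrossing centredSquareGraph zS Ω δ A B) ≤
      (bondPercolation (zdGraph 2) half).real
        (embDomainCrossing squareLatticeEmbedding.z (Metric.thickening δ Ω) δ
          (Metric.thickening δ A) (Metric.thickening δ B)) := by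
  rw [cover_zS_eq, cover_real_preimage (cover_measurableSet_siteCross hΩ hδ.ne' A B)]
  refine measureReal_mono ((cover_preimage_siteCross_subset Ω A B hδ).trans ?_)
  exact cover_openCrossing_mono subset_rfl (fun u hu => cover_infDist_thickening_le hδ hu)
    (fun v hv => cover_infDist_thickening_le hδ hv)

/-- **The fixed-mesh squeeze.** For every `δ > 0` the crude bond crossing probability of `R` and the crude
mixed (`q = 0`) crossing probability of `R` both lie between `P^{bond}(small_δ)` and `P^{bond}(big_δ)`.
[cite: Beffara2008Universal, §5.1] -/
theorem cover_squeeze (R : ConformalRectangle) {δ : ℝ} (hδ : 0 < δ) :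
    let Pb := bondPercolation (zdGraph 2) half
    let small := Pb.real (embDomainCrossing squareLatticeEmbedding.z
      {w | Metric.closedBall w δ ⊆ R.carrier} δ (R.arc 0) (R.arc 2))
    let big := Pb.real (embDomainCrossing squareLatticeEmbedding.z (Metric.thickening δ R.carrier) δ
      (Metric.thickening δ (R.arc 0)) (Metric.thickening δ (R.arc 2)))
    small ≤ bondProb R δ ∧ bondProb R δ ≤ big ∧
      small ≤ (lawP 0).real (crossS R δ) ∧ (lawP 0).real (crossS R δ) ≤ big := by
  dsimp only
  have hs : (lawP 0).real (crossS R δ) = (prodBernoulli (mixedParam 0)).real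
      (siteEmbDomainCrossing centredSquareGraph zS R.carrier δ (R.arc 0) (R.arc 2)) := by
    rw [crossS_eq, gsGraph_eq]; rfl
  refine ⟨?_, ?_, ?_, ?_⟩
  · refine measureReal_mono (cover_openCrossing_mono (fun y hy => ?_) subset_rfl subset_rfl)
    exact hy (Metric.mem_closedBall_self hδ.le)
  · refine measureReal_mono (cover_openCrossing_mono (fun y hy => ?_) (fun u hu => ?_) (fun v hv => ?_))
    · exact Metric.self_subset_thickening hδ _ hy
    · exact cover_infDist_thickening_le hδ (by simp only [Set.mem_setOf_eq] at hu; linarith)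
    · exact cover_infDist_thickening_le hδ (by simp only [Set.mem_setOf_eq] at hv; linarith)
  · rw [hs]; exact cover_prob_sandwich_lower _ _ _ hδ
  · rw [hs]; exact cover_prob_sandwich_upper R.isBounded _ _ hδ

/-- **`stub_coveringBridge` from boundary insensitivity.** If for every conformal rectangle the gap
`P^{bond}(big_δ) − P^{bond}(small_δ)` between the crude bond crossing probabilities of the `δ`-thickened data
`(Ω_δ; A_δ, B_δ)` and of the `δ`-eroded window tends to `0` as `δ → 0⁺`, then `CardySectorGap.CoveringBridge`
holds: by `cover_squeeze` both `bondProb R δ` and `P_{1/2,0}(cross_δ)` are squeezed in the gap, so they have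
the same limit inside every uniformizing datum. The hypothesis is the RSW-type estimate "open paths grazing
`∂Ω` do not change the limit" (Beffara 2008 §5.2; Grimmett–Manolescu 2014 §2.2), not in the tree.
[cite: Beffara2008Universal, §5.1–5.2] -/
theorem coveringBridge_of_boundaryInsensitivity : (∀ R : Literature.Probability.RandomPlanarGeometry.ConformalRectangle, Filter.Tendsto (fun δ : ℝ => (Literature.Probability.Percolation.bondPercolation (Literature.Probability.LatticeModels.zdGraph 2) Literature.Probability.Percolation.half).real (Literature.Probability.Percolation.embDomainCrossing Literature.Probability.LatticeModels.squareLatticeEmbedding.z (Metric.thickening δ R.carrier) δ (Metric.thickening δ (R.arc 0)) (Metric.thickening δ (R.arc 2))) - (Literature.Probability.Percolation.bondPercolation (Literature.Probability.LatticeModels.zdGraph 2) Literature.Probability.Percolation.half).real (Literature.Probability.Percolation.embDomainCrossing Literature.Probability.LatticeModels.squareLatticeEmbedding.z {w | Metric.closedBall w δ ⊆ R.carrier} δ (R.arc 0) (R.arc 2))) (nhdsWithin 0 (Set.Ioi 0)) (nhds 0)) → Summit.CriticalPhenomena.CardyFormulaZ2.Theses.CardySectorGap.CoveringBridge := by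
  intro hI
  rw [coveringBridge_iff]
  intro hM R φ x hφ
  have hlim := hM R φ x hφ
  have hgap := hI R
  refine tendsto_of_tendsto_of_tendsto_of_le_of_le' (by simpa using hlim.sub hgap)
    (by simpa using hlim.add hgap) ?_ ?_
  · filter_upwards [self_mem_nhdsWithin] with δ hδ
    obtain ⟨h1, h2, h3, h4⟩ := cover_squeeze R (Set.mem_Ioi.1 hδ)
    linarith
  · filter_upwards [self_mem_nhdsWithin] with δ hδ
    obtain ⟨h1, h2, h3, h4⟩ := cover_squeeze R (Set.mem_Ioi.1 hδ)
    linarith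

end Summit.CriticalPhenomena.CardyFormulaZ2.Cruxes.CoveringLeg.FiveArmNull

end
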